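import Mathlib
import Summits.KontsevichZagierPeriods.Zeta5Search.Families.CoeffAsympFace
import HarnessLib

/-!
# ζ(5) search — Families: coefficient asymptotics of powers of a positive polynomial, III — the tilt attains its
# minimum on the face; the tilted measure

HONEST FRAMING: systematic search; no irrationality claim unless certified.  Cell `pub-zeta5`, certifier 2
(cert-2 g9, 2026-08-22).  Elementary real analysis (extreme value theorem, one derivative); no conjecture node is
used; nothing about `ζ(5)`; no number of record moves.

For a finite set of monomials `F`, positive coefficients `c` and a base exponent `B` carrying a POSITIVE relation
`μ > 0` on `F`, `Σ_{α ∈ F} μ_α (α − B) = 0` (as produced by `Families/CoeffAsympFace.exists_pos_relation_face`):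
* **`exists_isMinOn_tilt`** — the tilt `u ↦ Σ_{α ∈ F} c_α e^{(α−B)·u}` ATTAINS its infimum on `ℝ^d` (it is constant
  along the annihilator `Z` of the vectors `α − B` and coercive on a complement of `Z`: on the unit sphere there the
  largest exponent `max_α (α−B)·v` is positive);
* **`tilt_mean_eq`** — at a minimum `u₀` the TILTED MEASURE `μ*_α = c_α e^{(α−B)·u₀}/tilt(u₀)` has mean `B`:
  `Σ_α c_α e^{(α−B)·u₀} (α_i − B_i) = 0` (Fermat in each coordinate direction);
* **`entropy_tilted_eq_log_tilt`** — and its entropy functional equals the log of the minimum: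
  `Σ_α (−μ*_α log μ*_α + μ*_α log c_α) = log tilt(u₀)`.
Standard axioms only.
-/

noncomputable section

open Finset Real Filter Topology

namespace Summit.KontsevichZagierPeriods.Zeta5Search.Families.Cellular

namespace CoeffAsymp

variable {d : ℕ}

/-! ## Linearity and continuity of the tilt -/

/-- `u ↦ (α − B)·u` as a linear functional. -/
def dotLin (B α : Fin d →₀ ℕ) : (Fin d → ℝ) →ₗ[ℝ] ℝ where
  toFun u := dot B α u
  map_add' u v := by
    simp only [dot, Pi.add_apply, mul_add, Finset.sum_add_distrib]
  map_smul' r u := by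
    simp only [dot, Pi.smul_apply, smul_eq_mul, RingHom.id_apply, Finset.mul_sum]
    exact Finset.sum_congr rfl fun i _ => by ring

/-- `dotLin B α u = dot B α u`. -/
@[simp] theorem dotLin_apply (B α : Fin d →₀ ℕ) (u : Fin d → ℝ) : dotLin B α u = dot B α u := rfl

/-- The annihilator of the vectors `α − B`, `α ∈ F`. -/
def annih (F : Finset (Fin d →₀ ℕ)) (B : Fin d →₀ ℕ) : Submodule ℝ (Fin d → ℝ) :=
  ⨅ α ∈ F, LinearMap.ker (dotLin B α)

/-- Membership in the annihilator. -/
theorem mem_annih {F : Finset (Fin d →₀ ℕ)} {B : Fin d →₀ ℕ} {u : Fin d → ℝ} :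
    u ∈ annih F B ↔ ∀ α ∈ F, dot B α u = 0 := by
  simp [annih, Submodule.mem_iInf]

/-- The tilt is continuous. -/
theorem continuous_tilt (F : Finset (Fin d →₀ ℕ)) (c : (Fin d →₀ ℕ) → ℝ) (B : Fin d →₀ ℕ) :
    Continuous (tilt F c B) := by
  unfold tilt dot
  refine continuous_finsetSum _ fun α _ => continuous_const.mul (Real.continuous_exp.comp ?_)
  exact continuous_finsetSum _ fun i _ => continuous_const.mul (continuous_apply i)

/-- The tilt only depends on `u` modulo the annihilator. -/
theorem tilt_eq_of_sub_mem_annih {F : Finset (Fin d →₀ ℕ)} (c : (Fin d →₀ ℕ) → ℝ) {B : Fin d →₀ ℕ}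
    {u v : Fin d → ℝ} (h : u - v ∈ annih F B) : tilt F c B u = tilt F c B v := by
  refine Finset.sum_congr rfl fun α hα => ?_
  have h0 : dot B α (u - v) = 0 := mem_annih.1 h α hα
  have : dot B α u = dot B α v := by
    have h1 : dotLin B α (u - v) = dotLin B α u - dotLin B α v := map_sub _ _ _
    rw [dotLin_apply, dotLin_apply, dotLin_apply] at h1
    linarith
  rw [this]

/-- The tilt is positive (`F` non-empty, `c > 0` on `F`). -/
theorem tilt_pos {F : Finset (Fin d →₀ ℕ)} {c : (Fin d →₀ ℕ) → ℝ} (hc : ∀ α ∈ F, 0 < c α) (hne : F.Nonempty)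
    (B : Fin d →₀ ℕ) (u : Fin d → ℝ) : 0 < tilt F c B u :=
  Finset.sum_pos (fun α hα => mul_pos (hc α hα) (Real.exp_pos _)) hne

/-- One term bounds the tilt from below. -/
theorem term_le_tilt {F : Finset (Fin d →₀ ℕ)} {c : (Fin d →₀ ℕ) → ℝ} (hc : ∀ α ∈ F, 0 < c α)
    (B : Fin d →₀ ℕ) (u : Fin d → ℝ) {α : Fin d →₀ ℕ} (hα : α ∈ F) :
    c α * Real.exp (dot B α u) ≤ tilt F c B u :=
  Finset.single_le_sum (f := fun β => c β * Real.exp (dot B β u))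
    (fun β hβ => (mul_pos (hc β hβ) (Real.exp_pos _)).le) hα

/-! ## Existence of the minimum -/

/-- A positive relation forces: if `(α − B)·v ≤ 0` for all `α ∈ F` then `(α − B)·v = 0` for all `α ∈ F`. -/
theorem dot_eq_zero_of_forall_nonpos {F : Finset (Fin d →₀ ℕ)} {B : Fin d →₀ ℕ} {μ : (Fin d →₀ ℕ) → ℝ}
    (hμ : ∀ α ∈ F, 0 < μ α) (hrel : ∀ i, ∑ α ∈ F, μ α * dvec B α i = 0) {v : Fin d → ℝ}
    (hle : ∀ α ∈ F, dot B α v ≤ 0) : ∀ α ∈ F, dot B α v = 0 := by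
  have hsum : ∑ α ∈ F, μ α * dot B α v = 0 := by
    unfold dot
    calc ∑ α ∈ F, μ α * ∑ i, dvec B α i * v i = ∑ α ∈ F, ∑ i, μ α * (dvec B α i * v i) := by
          simp_rw [Finset.mul_sum]
      _ = ∑ i, ∑ α ∈ F, μ α * (dvec B α i * v i) := Finset.sum_comm
      _ = ∑ i, v i * ∑ α ∈ F, μ α * dvec B α i := by
          refine Finset.sum_congr rfl fun i _ => ?_
          rw [Finset.mul_sum]
          exact Finset.sum_congr rfl fun α _ => by ring
      _ = 0 := by simp [hrel]
  have hneg : ∀ α ∈ F, 0 ≤ -(μ α * dot B α v) := fun α hα => by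
    have := mul_nonpos_iff.2 (Or.inl ⟨(hμ α hα).le, hle α hα⟩)
    linarith
  have hsum' : ∑ α ∈ F, -(μ α * dot B α v) = 0 := by rw [Finset.sum_neg_distrib, hsum, neg_zero]
  have hall := (Finset.sum_eq_zero_iff_of_nonneg hneg).1 hsum'
  intro α hα
  have h := hall α hα
  rw [neg_eq_zero] at h
  rcases mul_eq_zero.1 h with h | h
  · exact absurd h (hμ α hα).ne'
  · exact h

/-- **The tilt attains its minimum** on `ℝ^d` when `F` carries a positive relation (`c > 0` on `F`). -/
theorem exists_isMinOn_tilt {F : Finset (Fin d →₀ ℕ)} {c : (Fin d →₀ ℕ) → ℝ} (hc : ∀ α ∈ F, 0 < c α)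
    (hne : F.Nonempty) {B : Fin d →₀ ℕ} {μ : (Fin d →₀ ℕ) → ℝ} (hμ : ∀ α ∈ F, 0 < μ α)
    (hrel : ∀ i, ∑ α ∈ F, μ α * dvec B α i = 0) :
    ∃ u₀ : Fin d → ℝ, ∀ u, tilt F c B u₀ ≤ tilt F c B u := by
  classical
  obtain ⟨V, hZV⟩ := (annih F B).exists_isCompl
  -- (1) on `V`, non-positivity of all exponents forces `v = 0`
  have key : ∀ v : Fin d → ℝ, v ∈ V → (∀ α ∈ F, dot B α v ≤ 0) → v = 0 := by
    intro v hvV hle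
    have hvZ : v ∈ annih F B := mem_annih.2 (dot_eq_zero_of_forall_nonpos hμ hrel hle)
    exact (Submodule.disjoint_def.1 hZV.symm.disjoint) v hvV hvZ
  -- (2) the largest exponent `N v = max_α (α−B)·v` on the subtype `V`
  let N : V → ℝ := fun v => F.sup' hne fun α => dot B α (v : Fin d → ℝ)
  have hNcont : Continuous N :=
    Continuous.finset_sup'_apply hne fun α _ => (dotLin B α).continuous_of_finiteDimensional.comp
      continuous_subtype_val
  have hNpos : ∀ v : V, v ≠ 0 → 0 < N v := by
    intro v hv
    refine lt_of_not_ge fun h => hv (Subtype.ext (key v v.2 fun α hα => ?_))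
    exact le_trans (Finset.le_sup' (fun α => dot B α (v : Fin d → ℝ)) hα) h
  have hNhom : ∀ (t : ℝ) (v : V), 0 ≤ t → N (t • v) = t * N v := by
    intro t v ht
    simp only [N, Submodule.coe_smul]
    have : (fun α => dot B α (t • (v : Fin d → ℝ))) = fun α => t * dot B α (v : Fin d → ℝ) := by
      funext α
      rw [← dotLin_apply, map_smul, smul_eq_mul, dotLin_apply]
    rw [this]
    refine le_antisymm ?_ ?_
    · refine Finset.sup'_le hne _ fun α hα => ?_
      exact mul_le_mul_of_nonneg_left (Finset.le_sup' (fun α => dot B α (v : Fin d → ℝ)) hα) ht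
    · obtain ⟨α₀, hα₀, hmax⟩ := Finset.exists_mem_eq_sup' hne fun α => dot B α (v : Fin d → ℝ)
      rw [hmax]
      exact Finset.le_sup' (fun α => t * dot B α (v : Fin d → ℝ)) hα₀
  -- (3) a uniform constant: `m ‖v‖ ≤ N v` with `m > 0`
  obtain ⟨m, hm, hmN⟩ : ∃ m : ℝ, 0 < m ∧ ∀ v : V, m * ‖v‖ ≤ N v := by
    by_cases hV : ∀ v : V, v = 0
    swap
    · obtain ⟨w, hw⟩ := not_forall.1 hV
      have hsne : (Metric.sphere (0 : V) 1).Nonempty := by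
        refine ⟨(‖w‖⁻¹ : ℝ) • w, ?_⟩
        rw [mem_sphere_zero_iff_norm, norm_smul, norm_inv, norm_norm]
        exact inv_mul_cancel₀ (norm_ne_zero_iff.2 hw)
      obtain ⟨v₀, hv₀, hmin⟩ := (isCompact_sphere (0 : V) 1).exists_isMinOn hsne hNcont.continuousOn
      have hv₀1 : ‖v₀‖ = 1 := by simpa using hv₀
      have hv₀ne : v₀ ≠ 0 := by
        intro h; rw [h, norm_zero] at hv₀1; exact zero_ne_one hv₀1
      refine ⟨N v₀, hNpos v₀ hv₀ne, fun v => ?_⟩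
      by_cases hv : v = 0
      · subst hv
        have : N 0 = 0 := by simpa using hNhom 0 v₀ le_rfl
        simp [this]
      · have hnv : 0 < ‖v‖ := norm_pos_iff.2 hv
        have hunit : (‖v‖⁻¹ : ℝ) • v ∈ Metric.sphere (0 : V) 1 := by
          rw [mem_sphere_zero_iff_norm, norm_smul, norm_inv, norm_norm]
          exact inv_mul_cancel₀ hnv.ne'
        have h1 : N v₀ ≤ N ((‖v‖⁻¹ : ℝ) • v) := hmin hunit
        rw [hNhom _ _ (inv_nonneg.2 hnv.le)] at h1
        calc N v₀ * ‖v‖ ≤ (‖v‖⁻¹ * N v) * ‖v‖ := mul_le_mul_of_nonneg_right h1 hnv.le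
          _ = N v := by field_simp
    · refine ⟨1, one_pos, fun v => ?_⟩
      have h0 : N 0 = 0 := by
        have := hNhom 0 v le_rfl
        rwa [zero_smul, zero_mul] at this
      rw [hV v, norm_zero, mul_zero, h0]
  -- (4) coercivity of the tilt on `V`
  obtain ⟨α₁, hα₁⟩ := hne
  set cmin : ℝ := F.inf' ⟨α₁, hα₁⟩ c with hcmin
  have hcmin_pos : 0 < cmin := by
    obtain ⟨β, hβ, h⟩ := Finset.exists_mem_eq_inf' ⟨α₁, hα₁⟩ c
    rw [hcmin, h]; exact hc β hβ
  have hlow : ∀ v : V, cmin * Real.exp (m * ‖v‖) ≤ tilt F c B (v : Fin d → ℝ) := by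
    intro v
    obtain ⟨α₀, hα₀, hmax⟩ := Finset.exists_mem_eq_sup' ⟨α₁, hα₁⟩ fun α => dot B α (v : Fin d → ℝ)
    have h1 : m * ‖v‖ ≤ dot B α₀ (v : Fin d → ℝ) := by rw [← hmax]; exact hmN v
    calc cmin * Real.exp (m * ‖v‖) ≤ c α₀ * Real.exp (dot B α₀ (v : Fin d → ℝ)) :=
          mul_le_mul (Finset.inf'_le c hα₀) (Real.exp_le_exp.2 h1) (Real.exp_nonneg _) (hc α₀ hα₀).le
      _ ≤ tilt F c B (v : Fin d → ℝ) := term_le_tilt hc B _ hα₀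
  have htend : Tendsto (fun v : V => tilt F c B (v : Fin d → ℝ)) (cocompact V) atTop := by
    refine tendsto_atTop_mono hlow ?_
    refine Tendsto.const_mul_atTop hcmin_pos (Real.tendsto_exp_atTop.comp ?_)
    exact Tendsto.const_mul_atTop hm tendsto_norm_cocompact_atTop
  have hcontV : Continuous fun v : V => tilt F c B (v : Fin d → ℝ) :=
    (continuous_tilt F c B).comp continuous_subtype_val
  obtain ⟨v₀, hv₀⟩ := hcontV.exists_forall_le htend
  -- (5) project an arbitrary `u` to `V` along the annihilator
  refine ⟨(v₀ : Fin d → ℝ), fun u => ?_⟩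
  have hmem : u - V.projection (annih F B) hZV.symm u ∈ annih F B := Submodule.sub_projection_mem hZV.symm u
  rw [tilt_eq_of_sub_mem_annih c hmem]
  rw [Submodule.projection_apply]
  exact hv₀ (V.projectionOnto (annih F B) hZV.symm u)

/-! ## The tilted measure at a minimum -/

/-- `(α − B)·(u + t e_i) = (α − B)·u + t (α_i − B_i)`. -/
theorem dot_add_smul_single (B α : Fin d →₀ ℕ) (u : Fin d → ℝ) (t : ℝ) (i : Fin d) :
    dot B α (u + t • Pi.single i 1) = dot B α u + t * dvec B α i := by
  classical
  unfold dot
  simp only [Pi.add_apply, Pi.smul_apply, Pi.single_apply, smul_eq_mul, mul_ite, mul_one, mul_zero, mul_add,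
    Finset.sum_add_distrib, Finset.sum_ite_eq', Finset.mem_univ, if_true]
  ring

/-- **Fermat**: at a minimum of the tilt the tilted measure has mean `B`:
`Σ_α c_α e^{(α−B)·u₀} (α_i − B_i) = 0` for every `i`. -/
theorem tilt_mean_eq {F : Finset (Fin d →₀ ℕ)} {c : (Fin d →₀ ℕ) → ℝ} {B : Fin d →₀ ℕ} {u₀ : Fin d → ℝ}
    (hmin : ∀ u, tilt F c B u₀ ≤ tilt F c B u) (i : Fin d) :
    ∑ α ∈ F, c α * Real.exp (dot B α u₀) * dvec B α i = 0 := by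
  set φ : ℝ → ℝ := fun t => tilt F c B (u₀ + t • Pi.single i 1) with hφ
  have hderiv : HasDerivAt φ (∑ α ∈ F, c α * Real.exp (dot B α u₀) * dvec B α i) 0 := by
    have h : ∀ α ∈ F, HasDerivAt (fun t : ℝ => c α * Real.exp (dot B α u₀ + t * dvec B α i))
        (c α * Real.exp (dot B α u₀) * dvec B α i) 0 := by
      intro α _
      have h1 : HasDerivAt (fun t : ℝ => dot B α u₀ + t * dvec B α i) (dvec B α i) 0 := by
        simpa using ((hasDerivAt_id (0 : ℝ)).mul_const (dvec B α i)).const_add (dot B α u₀)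
      have h2 := (h1.exp).const_mul (c α)
      simpa [mul_assoc] using h2
    have hs := HasDerivAt.fun_sum h
    refine hs.congr_of_eventuallyEq (Filter.Eventually.of_forall fun t => ?_)
    simp only [hφ, tilt, dot_add_smul_single]
  have hloc : IsLocalMin φ 0 := Filter.Eventually.of_forall fun t => by
    simp only [hφ, zero_smul, add_zero]
    exact hmin _
  exact hloc.hasDerivAt_eq_zero hderiv

/-- The tilted measure `μ*_α = c_α e^{(α−B)·u₀} / tilt(u₀)`. -/
def tilted (F : Finset (Fin d →₀ ℕ)) (c : (Fin d →₀ ℕ) → ℝ) (B : Fin d →₀ ℕ) (u₀ : Fin d → ℝ)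
    (α : Fin d →₀ ℕ) : ℝ :=
  c α * Real.exp (dot B α u₀) / tilt F c B u₀

/-- The tilted measure is positive on `F`. -/
theorem tilted_pos {F : Finset (Fin d →₀ ℕ)} {c : (Fin d →₀ ℕ) → ℝ} (hc : ∀ α ∈ F, 0 < c α) (hne : F.Nonempty)
    (B : Fin d →₀ ℕ) (u₀ : Fin d → ℝ) {α : Fin d →₀ ℕ} (hα : α ∈ F) : 0 < tilted F c B u₀ α :=
  div_pos (mul_pos (hc α hα) (Real.exp_pos _)) (tilt_pos hc hne B u₀)

/-- The tilted measure has total mass `1`. -/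
theorem sum_tilted {F : Finset (Fin d →₀ ℕ)} {c : (Fin d →₀ ℕ) → ℝ} (hc : ∀ α ∈ F, 0 < c α) (hne : F.Nonempty)
    (B : Fin d →₀ ℕ) (u₀ : Fin d → ℝ) : ∑ α ∈ F, tilted F c B u₀ α = 1 := by
  unfold tilted
  rw [← Finset.sum_div, div_eq_one_iff_eq (tilt_pos hc hne B u₀).ne']
  rfl

/-- At a minimum the tilted measure has mean `B`: `Σ_α μ*_α (α_i − B_i) = 0`. -/
theorem sum_tilted_mul_dvec {F : Finset (Fin d →₀ ℕ)} {c : (Fin d →₀ ℕ) → ℝ} (hc : ∀ α ∈ F, 0 < c α)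
    (hne : F.Nonempty) {B : Fin d →₀ ℕ} {u₀ : Fin d → ℝ} (hmin : ∀ u, tilt F c B u₀ ≤ tilt F c B u)
    (i : Fin d) : ∑ α ∈ F, tilted F c B u₀ α * dvec B α i = 0 := by
  unfold tilted
  have hT := (tilt_pos hc hne B u₀).ne'
  have h := tilt_mean_eq hmin i
  calc ∑ α ∈ F, c α * Real.exp (dot B α u₀) / tilt F c B u₀ * dvec B α i
      = (∑ α ∈ F, c α * Real.exp (dot B α u₀) * dvec B α i) / tilt F c B u₀ := by
        rw [Finset.sum_div]
        exact Finset.sum_congr rfl fun α _ => by ring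
    _ = 0 := by rw [h, zero_div]

/-- **The entropy functional of the tilted measure is the log of the minimum**:
`Σ_α (−μ*_α log μ*_α + μ*_α log c_α) = log tilt(u₀)`. -/
theorem entropy_tilted_eq_log_tilt {F : Finset (Fin d →₀ ℕ)} {c : (Fin d →₀ ℕ) → ℝ} (hc : ∀ α ∈ F, 0 < c α)
    (hne : F.Nonempty) {B : Fin d →₀ ℕ} {u₀ : Fin d → ℝ} (hmin : ∀ u, tilt F c B u₀ ≤ tilt F c B u) :
    ∑ α ∈ F, (Real.negMulLog (tilted F c B u₀ α) + tilted F c B u₀ α * Real.log (c α)) =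
      Real.log (tilt F c B u₀) := by
  have hT := tilt_pos hc hne B u₀
  -- termwise: `−μ log μ + μ log c = −μ (α−B)·u₀ + μ log T`
  have hterm : ∀ α ∈ F, Real.negMulLog (tilted F c B u₀ α) + tilted F c B u₀ α * Real.log (c α) =
      -(tilted F c B u₀ α * dot B α u₀) + tilted F c B u₀ α * Real.log (tilt F c B u₀) := by
    intro α hα
    have hcα := hc α hα
    have hlog : Real.log (tilted F c B u₀ α) = Real.log (c α) + dot B α u₀ - Real.log (tilt F c B u₀) := by
      unfold tilted
      rw [Real.log_div (mul_pos hcα (Real.exp_pos _)).ne' hT.ne', Real.log_mul hcα.ne' (Real.exp_pos _).ne',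
        Real.log_exp]
    rw [Real.negMulLog, hlog]
    ring
  rw [Finset.sum_congr rfl hterm, Finset.sum_add_distrib, ← Finset.sum_mul, sum_tilted hc hne B u₀, one_mul,
    Finset.sum_neg_distrib]
  -- the first sum is `Σ_i u₀_i · (Σ_α μ*_α (α_i − B_i)) = 0`
  have h0 : ∑ α ∈ F, tilted F c B u₀ α * dot B α u₀ = 0 := by
    unfold dot
    calc ∑ α ∈ F, tilted F c B u₀ α * ∑ i, dvec B α i * u₀ i
        = ∑ α ∈ F, ∑ i, tilted F c B u₀ α * (dvec B α i * u₀ i) := by simp_rw [Finset.mul_sum]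
      _ = ∑ i, ∑ α ∈ F, tilted F c B u₀ α * (dvec B α i * u₀ i) := Finset.sum_comm
      _ = ∑ i, u₀ i * ∑ α ∈ F, tilted F c B u₀ α * dvec B α i := by
          refine Finset.sum_congr rfl fun i _ => ?_
          rw [Finset.mul_sum]
          exact Finset.sum_congr rfl fun α _ => by ring
      _ = 0 := by simp [sum_tilted_mul_dvec hc hne hmin]
  rw [h0, neg_zero, zero_add]

end CoeffAsymp

end Summit.KontsevichZagierPeriods.Zeta5Search.Families.Cellular
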